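import Mathlib.RingTheory.Coprime.Lemmas
import Mathlib.Data.Fintype.Pi
import Literature.ModelTheory.FiniteModelTheory.CohomologicalConsistency
import Literature.ModelTheory.FiniteModelTheory.OrConstructionObstruction
import HarnessLib

/-!
# Rational linear sections and the Bezout combination (Berkholz–Grohe, Lichter–Pago Lemma 2.2)

Topic `Literature/ModelTheory/FiniteModelTheory`; support file for the discharge of
`LichterPago2025_cohomologyFooled` (`CohomologicalConsistencyLimits.lean`).

Ó Conghaile's `ℤ`-extendability `ZExt k 𝓢 C s` (`CohomologicalConsistency.lean`) asks for an INTEGRAL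
compatible family of formal combinations of sections of `𝓢` with `r_C = 1·s`.  The standard way to
produce one (Berkholz–Grohe 2017; Lichter–Pago 2025, Lemma 2.2) is to produce two RATIONAL compatible
families with the same support and base conditions, one with denominators a power of `a` and one with
denominators a power of `c` for coprime `a, c` (in the application: uniform distributions over solution
spaces of linear systems over `𝔽₂` and over `𝔽₃`, "`p`-solutions"), and to combine them with Bezout
coefficients `αa^i + βc^j = 1`: every constraint is affine with integral coefficients, so the combination
again satisfies it, and it is integral.

* `SectionSystem.IsRatSection k 𝓢 C s w` — `w : (U : Finset A) → (↥U → B) → ℚ` is a RATIONAL LINEAR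
  SECTION of `𝓢` at level `k` based at `(C, s)`: supported in `𝓢`, compatible under restriction of
  contexts of size `≤ k` (`∑_{t|D = t'} w_U(t) = w_D(t')`), and `w_C = 𝟙_{s}`.
* `SectionSystem.ZExt.of_isRatSection` — an integer-valued rational linear section gives `ZExt`.
* `SectionSystem.IsRatSection.combine` — the Bezout combination `u·w₂ + v·w₃` (`u + v = 1` not needed:
  any `ℚ`-affine combination with `u + v = 1`) of two rational linear sections is one.
* `SectionSystem.ZExt.of_isRatSection_coprime` — **Lemma 2.2 of Lichter–Pago / Berkholz–Grohe for
  `ℤ`-extendability**: rational linear sections `w₂, w₃` based at `(C,s)` with `a · w₂` and `c · w₃`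
  integer-valued for coprime naturals `a, c` yield `ZExt k 𝓢 C s`.

## References

* [BerkholzGrohe2016] C. Berkholz, M. Grohe, *Linear Diophantine equations, group CSPs, and graph
  isomorphism*, SODA 2017 = arXiv:1607.04287, §4 (Lemma: a `p`-solution and a `q`-solution give an
  integral solution).
* [LichterPago2025] M. Lichter, B. Pago, *Limitations of affine integer relaxations for solving
  constraint satisfaction problems*, arXiv:2407.09097, Def. 2.1 (p-solutions), Lemma 2.2.
* [OConghaile2022] A. Ó Conghaile, *Cohomology in constraint satisfaction and structure isomorphism*,
  MFCS 2022 = arXiv:2206.15253, §4.2 (`ℤext`).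
-/

namespace Literature.ModelTheory.FiniteModelTheory

open Finset

namespace SectionSystem

universe u v

variable {A : Type u} {B : Type v} [DecidableEq A] [Fintype B] [DecidableEq B]

/-- `w` is a RATIONAL LINEAR SECTION of `𝓢` at level `k` based at `(C, s)`: a `ℚ`-valued weight on the
sections over every context, supported in `𝓢`, compatible under restriction along `D ⊆ U` for contexts
`U` of size `≤ k` (the push-forward of `w_U` is `w_D`), and equal to the indicator of `s` on `C`.  With
values in `{0} ∪ p^ℤ` this is a "`p`-solution with `x_{C,s} = 1`" of the width-`k` system.
[cite: LichterPago2025, Def. 2.1 and §5.4 (solutions with a fixed local section)] -/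
structure IsRatSection (k : ℕ) (S : SectionSystem A B) (C : Finset A) (s : ↥C → B)
    (w : (U : Finset A) → (↥U → B) → ℚ) : Prop where
  /-- support inside `𝓢` -/
  support : ∀ (U : Finset A) (t : ↥U → B), w U t ≠ 0 → t ∈ S U
  /-- compatibility: the push-forward of `w_U` along restriction to `D ⊆ U` is `w_D` (`|U| ≤ k`) -/
  compat : ∀ ⦃D U : Finset A⦄ (h : D ⊆ U), U.card ≤ k → ∀ t' : ↥D → B,
    ∑ t, (if SectionSystem.restrict h t = t' then w U t else 0) = w D t'
  /-- base: `w_C` is the indicator of `s` -/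
  base : ∀ t : ↥C → B, w C t = if t = s then 1 else 0

variable {k : ℕ} {S : SectionSystem A B} {C : Finset A} {s : ↥C → B}

/-- **An integer-valued rational linear section is a `ℤ`-linear section**: `ZExt k 𝓢 C s`.
[cite: OConghaile2022, §4.2 (ℤext)] -/
theorem ZExt.of_isRatSection {w : (U : Finset A) → (↥U → B) → ℚ} (hw : IsRatSection k S C s w)
    (hint : ∀ (U : Finset A) (t : ↥U → B), ∃ z : ℤ, w U t = z) : ZExt k S C s := by
  classical
  choose z hz using hint
  -- the integral family
  let r : ZSections A B := fun U => Finsupp.onFinset Finset.univ (z U) (fun _ _ => Finset.mem_univ _)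
  have hr : ∀ U t, r U t = z U t := fun U t => Finsupp.onFinset_apply
  refine ⟨r, ⟨fun U t ht => hw.support U t ?_, fun D U hDU hU => ?_⟩, ?_⟩
  · rw [hr] at ht
    rw [hz]
    exact_mod_cast ht
  · ext t'
    rw [mapDomain_apply_eq_sum_filter, hr]
    have h1 : ∑ a ∈ (r U).support.filter (fun a => SectionSystem.restrict hDU a = t'), (r U) a =
        ∑ t, if SectionSystem.restrict hDU t = t' then z U t else 0 := by
      rw [← Finset.sum_filter]
      refine Finset.sum_subset (filter_subset_filter _ (subset_univ _)) fun t htmem ht => ?_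
      rw [hr]
      by_contra hne
      exact ht (mem_filter.2 ⟨Finsupp.mem_support_iff.2 (by rwa [hr]), (mem_filter.1 htmem).2⟩)
    · rw [h1]
      have h2 := hw.compat hDU hU t'
      rw [hz] at h2
      have h3 : (∑ t, (if SectionSystem.restrict hDU t = t' then z U t else 0) : ℤ) =
          ((∑ t, if SectionSystem.restrict hDU t = t' then w U t else 0 : ℚ)) := by
        push_cast
        refine Finset.sum_congr rfl fun t _ => ?_
        split_ifs <;> simp [hz]
      exact_mod_cast h3.trans h2
  · ext t
    rw [hr, Finsupp.single_apply]
    have h := hw.base t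
    rw [hz] at h
    by_cases hts : t = s
    · subst hts
      simp only [if_true] at h ⊢
      exact_mod_cast h
    · rw [if_neg hts] at h
      rw [if_neg (Ne.symm hts)]
      exact_mod_cast h

/-- Affine combinations (`u + v = 1`) of rational linear sections based at the same `(C,s)` are rational
linear sections: every defining condition is affine. [cite: LichterPago2025, Lemma 2.2 (proof)] -/
theorem IsRatSection.combine {w₂ w₃ : (U : Finset A) → (↥U → B) → ℚ} (h₂ : IsRatSection k S C s w₂)
    (h₃ : IsRatSection k S C s w₃) {u v : ℚ} (huv : u + v = 1) :
    IsRatSection k S C s (fun U t => u * w₂ U t + v * w₃ U t) := by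
  refine ⟨fun U t ht => ?_, fun D U hDU hU t' => ?_, fun t => ?_⟩
  · by_contra hmem
    have e₂ : w₂ U t = 0 := by by_contra h; exact hmem (h₂.support U t h)
    have e₃ : w₃ U t = 0 := by by_contra h; exact hmem (h₃.support U t h)
    exact ht (by rw [e₂, e₃, mul_zero, mul_zero, add_zero])
  · have c₂ := h₂.compat hDU hU t'
    have c₃ := h₃.compat hDU hU t'
    rw [← c₂, ← c₃, Finset.mul_sum, Finset.mul_sum, ← Finset.sum_add_distrib]
    refine Finset.sum_congr rfl fun t _ => ?_
    split_ifs <;> ring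
  · rw [h₂.base t, h₃.base t]
    split_ifs
    · rw [mul_one, mul_one, huv]
    · rw [mul_zero, mul_zero, add_zero]

/-- **The Bezout combination (Berkholz–Grohe; Lichter–Pago, Lemma 2.2) for `ℤ`-extendability.**  If
`w₂` and `w₃` are rational linear sections of `𝓢` at level `k` based at `(C,s)` such that `a · w₂` and
`c · w₃` are integer-valued for coprime naturals `a, c` (e.g. a `2`-adic and a `3`-adic family, scaled
by `2^i` and `3^j`), then `s` is `ℤ`-extendable in `𝓢` at level `k`: with `αa + βc = 1` the family
`αa·w₂ + βc·w₃` is an integral linear section based at `(C,s)`, supported where `w₂` or `w₃` is.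
[cite: LichterPago2025, Lemma 2.2; BerkholzGrohe2016, §4] -/
theorem ZExt.of_isRatSection_coprime {w₂ w₃ : (U : Finset A) → (↥U → B) → ℚ}
    (h₂ : IsRatSection k S C s w₂) (h₃ : IsRatSection k S C s w₃) {a c : ℕ} (hac : Nat.Coprime a c)
    (hi₂ : ∀ (U : Finset A) (t : ↥U → B), ∃ z : ℤ, (a : ℚ) * w₂ U t = z)
    (hi₃ : ∀ (U : Finset A) (t : ↥U → B), ∃ z : ℤ, (c : ℚ) * w₃ U t = z) : ZExt k S C s := by
  obtain ⟨α, β, hαβ⟩ := Nat.isCoprime_iff_coprime.2 hac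
  have huv : (α * a : ℚ) + (β * c : ℚ) = 1 := by exact_mod_cast hαβ
  refine ZExt.of_isRatSection (h₂.combine h₃ huv) fun U t => ?_
  obtain ⟨z₂, hz₂⟩ := hi₂ U t
  obtain ⟨z₃, hz₃⟩ := hi₃ U t
  refine ⟨α * z₂ + β * z₃, ?_⟩
  push_cast
  rw [← hz₂, ← hz₃]
  ring

end SectionSystem

end Literature.ModelTheory.FiniteModelTheory
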